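import Mathlib
import Summits.NavierStokesRegularity.FluidComputer.AbcFlowCubeTailForms
import Summits.NavierStokesRegularity.FluidComputer.AbcKappa0TailLevels
import HarnessLib

/-!
# The D2 tail box at `(R, ω, K) = (100, 0.22, 24)`: the three tail levels of the true ABC linearisation as NUMBERS (cap g5, cell `ns-blowup`, 2026-08-26)

HONEST FRAMING (human ruling D-0035): nothing here is a claim about Navier–Stokes blow-up.
WHAT THIS IS NOT: not NS evidence. The instance the D2-3L-X0 certificates of record use
(PREREG STATUS l.1438; RESULTs l.1949 / l.2180 / l.2463 / l.2492 / l.2695: `R = 100`, `ω = 11/50`,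
head `K = 24`, tail `|k|_∞ ≥ 25`): `AbcFlowCubeTailForms` (p437370) composed with the threshold
arithmetic of `AbcKappa0TailLevels` (p416347/p417595). For `U = Torus.abcFlow 1 1 1` on the unit torus
and every smooth `w` whose Fourier coefficients vanish on the cube `|k|_∞ ≤ 24`:

* `abc_cube_h2_tail_at_25` — `(ν/4π²)∫⟪ΔΔw,Δw⟫ − (1/2π)∫⟪(U·∇)w + (w·∇)U, ΔΔw⟫ − ω‖Δw‖₂² ≤ −1.352·‖Δw‖₂²`
  (`η_t = η₂ ≥ 1.352`; the ball stage printed `eta_t >= 1.3523`);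
* `abc_cube_h1_tail_at_25` — the `H¹` form `≤ −3.254·‖∇w‖₂²` (`η₁' ≥ 3.254`);
* `abc_cube_l2_tail_at_25` — the `L²` form `≤ −5.055·‖w‖₂²` (`η₀ ≥ 5.055`),

with `ν = 1/100`. These are the three hypotheses of `AbcKappa0TailLevels.weighted_levels_le` for the
booking norm `g_κ₀` as THEOREMS about the tree's ABC field — the «tail box» of the D2 THEOREM-GRADE
criterion (iii) (referee g25 STATUS l.3234 «stays UNTICKED until the cube-Poincaré fix»).

Mathlib + `AbcFlowCubeTailForms` + `AbcKappa0TailLevels`; no new definitions.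
-/

noncomputable section

namespace Summit.NavierStokesRegularity.FluidComputer.AbcFlowCubeTailAt25

open Literature.Analysis.FluidPDE Literature.Analysis.FunctionSpaces
open Literature.Analysis.FunctionSpaces.Torus MeasureTheory UnitAddTorus
open Summit.NavierStokesRegularity.FluidComputer.AbcFlowCubeTailForms
open Summit.NavierStokesRegularity.FluidComputer.AbcKappa0TailLevels
open scoped RealInnerProductSpace

/-- **The `H²` tail level of the D2 certificates as a number: `η_t = η₂ ≥ 1.352`.** -/
theorem abc_cube_h2_tail_at_25 {w : UnitAddTorus (Fin 3) → EuclideanSpace ℝ (Fin 3)} (hw : IsSmooth w)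
    (hcube : ∀ k : Fin 3 → ℤ, (∀ i, |k i| ≤ (24 : ℤ)) →
      mFourierCoeff (EuclideanSpace.complexify ∘ w) k = 0) :
    (1 / 100 : ℝ) / (4 * Real.pi ^ 2) * (∫ y, ⟪laplacian (laplacian w) y, laplacian w y⟫)
      - 1 / (2 * Real.pi) * (∫ y, ⟪convect (Torus.abcFlow 1 1 1) w y + convect w (Torus.abcFlow 1 1 1) y,
          laplacian (laplacian w) y⟫)
      - (11 / 50 : ℝ) * (∫ y, ‖laplacian w y‖ ^ 2)
      ≤ -(1.352 : ℝ) * (∫ y, ‖laplacian w y‖ ^ 2) := by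
  have hcube' : ∀ k : Fin 3 → ℤ, (∀ i, |k i| ≤ ((24 : ℕ) : ℤ)) →
      mFourierCoeff (EuclideanSpace.complexify ∘ w) k = 0 := fun k hk => hcube k (by simpa using hk)
  have h := abc_cube_h2_tail_form_le hw hcube' (ν := 1 / 100) (ω := 11 / 50) (by norm_num)
  have hY : 0 ≤ ∫ y, ‖laplacian w y‖ ^ 2 := integral_nonneg fun y => sq_nonneg _
  have hη := eta2_at_25_bounds.1
  have e : ((24 : ℕ) : ℝ) + 1 = 25 := by norm_num
  rw [e] at h
  refine h.trans ?_
  refine mul_le_mul_of_nonneg_right ?_ hY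
  linarith

/-- **The `H¹` tail level as a number: `η₁' ≥ 3.254`** (generic-constant variant
`AbcKappa0TailLevels.eta1_generic_at_25_gt`). -/
theorem abc_cube_h1_tail_at_25 {w : UnitAddTorus (Fin 3) → EuclideanSpace ℝ (Fin 3)} (hw : IsSmooth w)
    (hcube : ∀ k : Fin 3 → ℤ, (∀ i, |k i| ≤ (24 : ℤ)) →
      mFourierCoeff (EuclideanSpace.complexify ∘ w) k = 0) :
    -((1 / 100 : ℝ) / (4 * Real.pi ^ 2) * ∫ y, ‖laplacian w y‖ ^ 2)
      + 1 / (2 * Real.pi) * (∫ y, ⟪convect (Torus.abcFlow 1 1 1) w y + convect w (Torus.abcFlow 1 1 1) y,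
          laplacian w y⟫)
      - (11 / 50 : ℝ) * gradNormSq w
      ≤ -(3.254 : ℝ) * gradNormSq w := by
  have hcube' : ∀ k : Fin 3 → ℤ, (∀ i, |k i| ≤ ((24 : ℕ) : ℤ)) →
      mFourierCoeff (EuclideanSpace.complexify ∘ w) k = 0 := fun k hk => hcube k (by simpa using hk)
  have h := abc_cube_h1_tail_form_le hw hcube' (ν := 1 / 100) (ω := 11 / 50) (by norm_num)
  have hG : 0 ≤ gradNormSq w := gradNormSq_nonneg _
  have hη := eta1_generic_at_25_gt
  have e : ((24 : ℕ) : ℝ) + 1 = 25 := by norm_num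
  rw [e] at h
  refine h.trans (mul_le_mul_of_nonneg_right ?_ hG)
  linarith

/-- **The `L²` tail level as a number: `η₀ ≥ 5.055`** (`AbcKappa0TailLevels.eta0_at_25_gt`). -/
theorem abc_cube_l2_tail_at_25 {w : UnitAddTorus (Fin 3) → EuclideanSpace ℝ (Fin 3)} (hw : IsSmooth w)
    (hcube : ∀ k : Fin 3 → ℤ, (∀ i, |k i| ≤ (24 : ℤ)) →
      mFourierCoeff (EuclideanSpace.complexify ∘ w) k = 0) :
    (1 / 100 : ℝ) / (4 * Real.pi ^ 2) * (∫ y, ⟪laplacian w y, w y⟫)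
      - 1 / (2 * Real.pi) * (∫ y, ⟪convect (Torus.abcFlow 1 1 1) w y + convect w (Torus.abcFlow 1 1 1) y, w y⟫)
      - (11 / 50 : ℝ) * (∫ y, ‖w y‖ ^ 2)
      ≤ -(5.055 : ℝ) * (∫ y, ‖w y‖ ^ 2) := by
  have hcube' : ∀ k : Fin 3 → ℤ, (∀ i, |k i| ≤ ((24 : ℕ) : ℤ)) →
      mFourierCoeff (EuclideanSpace.complexify ∘ w) k = 0 := fun k hk => hcube k (by simpa using hk)
  have h := abc_cube_l2_tail_form_le hw hcube' (ν := 1 / 100) (by norm_num) (11 / 50 : ℝ)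
  have hE : 0 ≤ ∫ y, ‖w y‖ ^ 2 := integral_nonneg fun y => sq_nonneg _
  have hη := eta0_at_25_gt
  have e : ((24 : ℕ) : ℝ) + 1 = 25 := by norm_num
  rw [e] at h
  refine h.trans (mul_le_mul_of_nonneg_right ?_ hE)
  linarith

end Summit.NavierStokesRegularity.FluidComputer.AbcFlowCubeTailAt25
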